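import Mathlib
import HarnessLib

/-!
# The Van Loan–Pitsianis rearrangement `𝓡(A)` and the Kronecker product SVD / Kronecker rank
(Golub–Van Loan §12.3.6, Theorem 12.3.1)

Topic `LinearAlgebra/TensorNetworks`. Golub–Van Loan, *Matrix Computations* (4th ed., 2013),
§12.3.6 "The Kronecker Product SVD" (held copy `book:golub2012-matrix-computations`, PDF
pp. 658–659): for `A ∈ R^{m₁m₂ × n₁n₂}` blocked as `A = (A_{ij})`, `A_{ij} ∈ R^{m₂ × n₂}` (12.3.16),
the REARRANGEMENT `𝓡(A) ∈ R^{m₁n₁ × m₂n₂}` has the rows `vec(A_{ij})ᵀ`; the nearest Kronecker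
product problem `φ(B, C) = ‖A − B ⊗ C‖_F` (12.3.14) becomes the nearest RANK-ONE problem
`φ(B, C) = ‖𝓡(A) − vec(B) vec(C)ᵀ‖_F` (display after (12.3.14)), and an expansion
`𝓡(A) = Σ_k σ_k u_k v_kᵀ` (12.3.17) reshapes to `A = Σ_k σ_k U_k ⊗ V_k` (12.3.18)
(**Theorem 12.3.1**, Kronecker Product SVD); "the integer `r` in the theorem is the Kronecker
product rank of `A` given the blocking (12.3.16)" — the rank of `𝓡(A)`.  The same material is
Van Loan, *The ubiquitous Kronecker product* (2000), §6 (held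
`paper:doi-10-1016-s0377-0427-00-00393-9`, pp. 93–95: `Ã = 𝓡(A)`,
`Ã(i + (j−1)m₁, :) = vec(A_{ij})ᵀ`; the KPSVD (9)–(10); "if `A` is the sum of `p` Kronecker
products … then `rank(𝓡(A)) ≤ p`"), after Van Loan–Pitsianis (1993); Grasedyck (2004, §5) calls
`rank 𝓡(A)` the *Kronecker rank*.

In Mathlib's indexing of `Matrix.kroneckerMap` — `(B ⊗ₖ C) (i, p) (j, q) = B i j * C p q`, rows
`m₁ × m₂`, columns `n₁ × n₂`, no linear order needed — the rearrangement is the index shuffle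
`𝓡(A) ((i, j), (p, q)) = A ((i, p), (j, q))` (`kronRearrange`, an involution up to the evident
retyping, `kronRearrange_kronRearrange`; a linear equivalence `kronRearrangeLinearEquiv`), and
the dictionary is

* `kronRearrange_kronecker : 𝓡(B ⊗ₖ C) = vecMulVec (vec B) (vec C)` and conversely
  `kronRearrange_vecMulVec : 𝓡(b cᵀ) = reshape b ⊗ₖ reshape c` (the mechanism of Thm. 12.3.1);
* `eq_sum_smul_kronecker_of_kronRearrange` — **Theorem 12.3.1**: an expansion
  `𝓡(A) = Σ_{k ∈ s} σ_k • u_k v_kᵀ` gives `A = Σ_{k ∈ s} σ_k • U_k ⊗ₖ V_k`, `U_k = reshape u_k`,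
  `V_k = reshape v_k` (any commutative semiring; the SVD is one source of such an expansion);
* `sum_sum_kronRearrange` (entrywise sums are invariant), whence for the Frobenius norm
  `frobenius_norm_kronRearrange : ‖𝓡(A)‖_F = ‖A‖_F` and the NKP reformulation
  `frobenius_norm_sub_kronecker : ‖A − B ⊗ₖ C‖_F = ‖𝓡(A) − vec(B) vec(C)ᵀ‖_F`;
* over a field: `kronRank A := (𝓡 A).rank`, `kronRank_le_card` (a sum of `|s|` Kronecker
  products has Kronecker rank `≤ |s|`), `exists_eq_sum_kronecker` (`A` IS a sum of exactly
  `kronRank A` Kronecker products — Thm. 12.3.1 fed with a rank factorisation of `𝓡(A)`), and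
  `isLeast_kronRank` (the Kronecker rank is the least number of Kronecker terms representing `A`).

All statements proved; no named facts.  The 2-site case of "TT-rank = unfolding rank"
(`TensorTrainSVD.lean`, tensors `(Fin N → σ) → ℝ`) is the vector analogue; here the object is an
operator with Kronecker-structured row AND column indices (the setting of `QTTLaplaceMulti.lean`'s
`kronPi` / Kazeev–Khoromskij and of Grasedyck's low-Kronecker-rank inverses).
-/

noncomputable section

open Matrix
open scoped Kronecker

namespace Literature.LinearAlgebra.TensorNetworks

universe u v

variable {R : Type u} {m₁ m₂ n₁ n₂ : Type*}

/-! ## The rearrangement -/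

section Def

/-- The Van Loan–Pitsianis rearrangement `𝓡(A)`: row index `(i, j)` = block position, column
index `(p, q)` = position inside the block, `𝓡(A) (i, j) (p, q) = A (i, p) (j, q)` (row `(i, j)` of
`𝓡(A)` is `vec(A_{ij})ᵀ`). [cite: GolubVanLoan2013, §12.3.6 (12.3.16)] -/
def kronRearrange (A : Matrix (m₁ × m₂) (n₁ × n₂) R) : Matrix (m₁ × n₁) (m₂ × n₂) R :=
  of fun ij pq => A (ij.1, pq.1) (ij.2, pq.2)

/-- Entries of `𝓡(A)`. [cite: GolubVanLoan2013, §12.3.6 (12.3.16)] -/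
@[simp] theorem kronRearrange_apply (A : Matrix (m₁ × m₂) (n₁ × n₂) R) (ij : m₁ × n₁)
    (pq : m₂ × n₂) : kronRearrange A ij pq = A (ij.1, pq.1) (ij.2, pq.2) := rfl

/-- `𝓡` is an involution (up to the evident retyping `m₂ ↔ n₁`): rearranging twice returns `A`.
[cite: GolubVanLoan2013, §12.3.6 (12.3.16)] -/
@[simp] theorem kronRearrange_kronRearrange (A : Matrix (m₁ × m₂) (n₁ × n₂) R) :
    kronRearrange (kronRearrange A) = A := by
  ext ⟨i, p⟩ ⟨j, q⟩
  rfl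

/-- `𝓡` is injective. [cite: GolubVanLoan2013, §12.3.6 (12.3.16)] -/
theorem kronRearrange_injective :
    Function.Injective (kronRearrange : Matrix (m₁ × m₂) (n₁ × n₂) R → _) := fun A B h => by
  rw [← kronRearrange_kronRearrange A, h, kronRearrange_kronRearrange]

/-- `𝓡` is a bijection (its inverse is `𝓡` with the retyped indices).
[cite: GolubVanLoan2013, §12.3.6 (12.3.16)] -/
def kronRearrangeEquiv : Matrix (m₁ × m₂) (n₁ × n₂) R ≃ Matrix (m₁ × n₁) (m₂ × n₂) R where
  toFun := kronRearrange
  invFun := kronRearrange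
  left_inv := kronRearrange_kronRearrange
  right_inv := kronRearrange_kronRearrange

/-- [cite: GolubVanLoan2013, §12.3.6 (12.3.16)] -/
@[simp] theorem kronRearrangeEquiv_apply (A : Matrix (m₁ × m₂) (n₁ × n₂) R) :
    kronRearrangeEquiv A = kronRearrange A := rfl

/-- `𝓡(Aᵀ) = 𝓡(A)` read through the swap of both index pairs.
[cite: GolubVanLoan2013, §12.3.6 (12.3.16)] -/
theorem kronRearrange_transpose (A : Matrix (m₁ × m₂) (n₁ × n₂) R) :
    kronRearrange Aᵀ = (kronRearrange A).submatrix Prod.swap Prod.swap := by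
  ext ⟨j, i⟩ ⟨q, p⟩
  rfl

end Def

/-! ## Linearity -/

section Linear

/-- [cite: GolubVanLoan2013, §12.3.6 (12.3.16)] -/
@[simp] theorem kronRearrange_zero [Zero R] :
    kronRearrange (0 : Matrix (m₁ × m₂) (n₁ × n₂) R) = 0 := rfl

/-- [cite: GolubVanLoan2013, §12.3.6 (12.3.16)] -/
@[simp] theorem kronRearrange_add [Add R] (A B : Matrix (m₁ × m₂) (n₁ × n₂) R) :
    kronRearrange (A + B) = kronRearrange A + kronRearrange B := rfl

/-- [cite: GolubVanLoan2013, §12.3.6 (12.3.16)] -/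
@[simp] theorem kronRearrange_neg [Neg R] (A : Matrix (m₁ × m₂) (n₁ × n₂) R) :
    kronRearrange (-A) = -kronRearrange A := rfl

/-- [cite: GolubVanLoan2013, §12.3.6 (12.3.16)] -/
@[simp] theorem kronRearrange_sub [Sub R] (A B : Matrix (m₁ × m₂) (n₁ × n₂) R) :
    kronRearrange (A - B) = kronRearrange A - kronRearrange B := rfl

/-- [cite: GolubVanLoan2013, §12.3.6 (12.3.16)] -/
@[simp] theorem kronRearrange_smul {S : Type*} [SMul S R] (c : S)
    (A : Matrix (m₁ × m₂) (n₁ × n₂) R) : kronRearrange (c • A) = c • kronRearrange A := rfl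

/-- [cite: GolubVanLoan2013, §12.3.6 (12.3.16)] -/
@[simp] theorem kronRearrange_sum [AddCommMonoid R] {ι : Type*} (s : Finset ι)
    (A : ι → Matrix (m₁ × m₂) (n₁ × n₂) R) :
    kronRearrange (∑ k ∈ s, A k) = ∑ k ∈ s, kronRearrange (A k) := by
  ext ij pq
  simp [Matrix.sum_apply]

/-- `𝓡` as a linear equivalence. [cite: GolubVanLoan2013, §12.3.6 (12.3.16)] -/
def kronRearrangeLinearEquiv (S : Type*) [Semiring S] [AddCommMonoid R] [Module S R] :
    Matrix (m₁ × m₂) (n₁ × n₂) R ≃ₗ[S] Matrix (m₁ × n₁) (m₂ × n₂) R :=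
  { kronRearrangeEquiv with
    map_add' := kronRearrange_add
    map_smul' := fun c A => kronRearrange_smul c A }

/-- [cite: GolubVanLoan2013, §12.3.6 (12.3.16)] -/
@[simp] theorem kronRearrangeLinearEquiv_apply (S : Type*) [Semiring S] [AddCommMonoid R]
    [Module S R] (A : Matrix (m₁ × m₂) (n₁ × n₂) R) :
    kronRearrangeLinearEquiv S A = kronRearrange A := rfl

end Linear

/-! ## Kronecker products become rank-one matrices, and back -/

section Kronecker

variable [Mul R]

/-- **`𝓡(B ⊗ C) = vec(B) vec(C)ᵀ`**: the rearrangement of a Kronecker product is the rank-one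
matrix `vecMulVec (vec B) (vec C)` (`vec B (i, j) = B i j`).
[cite: GolubVanLoan2013, §12.3.6 (12.3.14)-(12.3.15)] -/
@[simp] theorem kronRearrange_kronecker (B : Matrix m₁ n₁ R) (C : Matrix m₂ n₂ R) :
    kronRearrange (B ⊗ₖ C) = vecMulVec (fun ij => B ij.1 ij.2) fun pq => C pq.1 pq.2 := by
  ext ⟨i, j⟩ ⟨p, q⟩
  simp [vecMulVec_apply]

/-- **Reshaping a rank-one matrix gives a Kronecker product**: `𝓡(b cᵀ) = U ⊗ₖ V` with
`U = reshape b` (`U i j = b (i, j)`) and `V = reshape c` — the step "`U_k = reshape(u_k, m₁, n₁)`,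
`V_k = reshape(v_k, m₂, n₂)`" of Theorem 12.3.1. [cite: GolubVanLoan2013, Thm. 12.3.1] -/
@[simp] theorem kronRearrange_vecMulVec (b : m₁ × n₁ → R) (c : m₂ × n₂ → R) :
    kronRearrange (vecMulVec b c : Matrix (m₁ × n₁) (m₂ × n₂) R) =
      (of fun i j => b (i, j)) ⊗ₖ (of fun p q => c (p, q)) := by
  ext ⟨i, p⟩ ⟨j, q⟩
  simp [vecMulVec_apply]

/-- `B ⊗ₖ C = 𝓡(vec(B) vec(C)ᵀ)` (the retyped inverse direction).
[cite: GolubVanLoan2013, §12.3.6 (12.3.14)-(12.3.15)] -/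
theorem kronecker_eq_kronRearrange_vecMulVec (B : Matrix m₁ n₁ R) (C : Matrix m₂ n₂ R) :
    B ⊗ₖ C = kronRearrange (vecMulVec (fun ij : m₁ × n₁ => B ij.1 ij.2)
      fun pq : m₂ × n₂ => C pq.1 pq.2) := by
  rw [kronRearrange_vecMulVec]
  rfl

end Kronecker

section Sums

variable {ι : Type*}

/-- `𝓡 (Σ_k B_k ⊗ C_k) = Σ_k vec(B_k) vec(C_k)ᵀ`. [cite: GolubVanLoan2013, Thm. 12.3.1] -/
theorem kronRearrange_sum_kronecker [NonUnitalNonAssocSemiring R] (s : Finset ι)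
    (B : ι → Matrix m₁ n₁ R) (C : ι → Matrix m₂ n₂ R) :
    kronRearrange (∑ k ∈ s, B k ⊗ₖ C k) =
      ∑ k ∈ s, vecMulVec (fun ij => B k ij.1 ij.2) fun pq => C k pq.1 pq.2 := by
  rw [kronRearrange_sum]
  simp

/-- **Theorem 12.3.1 (Kronecker Product SVD, algebraic form).** If
`𝓡(A) = Σ_{k ∈ s} σ_k • u_k v_kᵀ` then `A = Σ_{k ∈ s} σ_k • U_k ⊗ₖ V_k` with `U_k = reshape u_k`,
`V_k = reshape v_k`.  (With `𝓡(A) = U Σ Vᵀ` the SVD, (12.3.17), this is (12.3.18); the statement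
holds for ANY such expansion over any semiring.) [cite: GolubVanLoan2013, Thm. 12.3.1] -/
theorem eq_sum_smul_kronecker_of_kronRearrange [Semiring R] {s : Finset ι} {σ : ι → R}
    {u : ι → m₁ × n₁ → R} {v : ι → m₂ × n₂ → R} {A : Matrix (m₁ × m₂) (n₁ × n₂) R}
    (h : kronRearrange A = ∑ k ∈ s, σ k • vecMulVec (u k) (v k)) :
    A = ∑ k ∈ s, σ k • (of fun i j => u k (i, j)) ⊗ₖ (of fun p q => v k (p, q)) := by
  apply kronRearrange_injective
  rw [h, kronRearrange_sum]
  simp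

/-- Theorem 12.3.1 without weights: `𝓡(A) = Σ_{k ∈ s} u_k v_kᵀ ⇒ A = Σ_{k ∈ s} U_k ⊗ₖ V_k`.
[cite: GolubVanLoan2013, Thm. 12.3.1] -/
theorem eq_sum_kronecker_of_kronRearrange [NonUnitalNonAssocSemiring R] {s : Finset ι}
    {u : ι → m₁ × n₁ → R} {v : ι → m₂ × n₂ → R} {A : Matrix (m₁ × m₂) (n₁ × n₂) R}
    (h : kronRearrange A = ∑ k ∈ s, vecMulVec (u k) (v k)) :
    A = ∑ k ∈ s, (of fun i j => u k (i, j)) ⊗ₖ (of fun p q => v k (p, q)) := by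
  apply kronRearrange_injective
  rw [h, kronRearrange_sum]
  simp

/-- The blocks: `A (i, p) (j, q) = Σ_k σ_k U_k(i, j) V_k(p, q)` ("`A_{ij} = Σ_k σ_k U_k(i,j) V_k`",
the proof of Theorem 12.3.1). [cite: GolubVanLoan2013, Thm. 12.3.1 (proof)] -/
theorem apply_eq_sum_of_kronRearrange [Semiring R] {s : Finset ι} {σ : ι → R}
    {u : ι → m₁ × n₁ → R} {v : ι → m₂ × n₂ → R} {A : Matrix (m₁ × m₂) (n₁ × n₂) R}
    (h : kronRearrange A = ∑ k ∈ s, σ k • vecMulVec (u k) (v k)) (i : m₁) (p : m₂) (j : n₁)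
    (q : n₂) : A (i, p) (j, q) = ∑ k ∈ s, σ k * u k (i, j) * v k (p, q) := by
  have := congr_fun (congr_fun h (i, j)) (p, q)
  simpa [Matrix.sum_apply, vecMulVec_apply, mul_assoc] using this

end Sums

/-! ## Entrywise sums and the Frobenius norm: the NKP problem is a nearest rank-one problem -/

section EntrySums

variable [Fintype m₁] [Fintype m₂] [Fintype n₁] [Fintype n₂]

/-- Entrywise sums are invariant under `𝓡` (it permutes the entries).
[cite: GolubVanLoan2013, §12.3.6 (12.3.14)-(12.3.15)] -/
theorem sum_sum_kronRearrange {S : Type*} [AddCommMonoid S] (f : R → S)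
    (A : Matrix (m₁ × m₂) (n₁ × n₂) R) :
    ∑ ij, ∑ pq, f (kronRearrange A ij pq) = ∑ ip, ∑ jq, f (A ip jq) := by
  simp only [Fintype.sum_prod_type, kronRearrange_apply]
  exact Finset.sum_congr rfl fun i _ => Finset.sum_comm

end EntrySums

section Frobenius

open scoped Matrix.Norms.Frobenius

variable [Fintype m₁] [Fintype m₂] [Fintype n₁] [Fintype n₂]

/-- `‖𝓡(A)‖_F = ‖A‖_F` (nnnorm form). [cite: GolubVanLoan2013, §12.3.6 (12.3.14)-(12.3.15)] -/
@[simp] theorem frobenius_nnnorm_kronRearrange [SeminormedAddCommGroup R]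
    (A : Matrix (m₁ × m₂) (n₁ × n₂) R) : ‖kronRearrange A‖₊ = ‖A‖₊ := by
  rw [Matrix.frobenius_nnnorm_def, Matrix.frobenius_nnnorm_def,
    sum_sum_kronRearrange (fun a : R => ‖a‖₊ ^ (2 : ℝ))]

/-- **`‖𝓡(A)‖_F = ‖A‖_F`**: the rearrangement is a Frobenius isometry.
[cite: GolubVanLoan2013, §12.3.6 (12.3.14)-(12.3.15)] -/
@[simp] theorem frobenius_norm_kronRearrange [SeminormedAddCommGroup R]
    (A : Matrix (m₁ × m₂) (n₁ × n₂) R) : ‖kronRearrange A‖ = ‖A‖ :=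
  congr_arg ((↑) : NNReal → ℝ) (frobenius_nnnorm_kronRearrange A)

/-- **The NKP problem is a nearest rank-one problem**:
`φ(B, C) = ‖A − B ⊗ C‖_F = ‖𝓡(A) − vec(B) vec(C)ᵀ‖_F`.
[cite: GolubVanLoan2013, §12.3.6 (12.3.14)-(12.3.15)] [cite: VanLoan2000, §6 (8)-(9)] -/
theorem frobenius_norm_sub_kronecker [NonUnitalSeminormedRing R]
    (A : Matrix (m₁ × m₂) (n₁ × n₂) R) (B : Matrix m₁ n₁ R) (C : Matrix m₂ n₂ R) :
    ‖A - B ⊗ₖ C‖ =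
      ‖kronRearrange A - vecMulVec (fun ij => B ij.1 ij.2) fun pq => C pq.1 pq.2‖ := by
  rw [← frobenius_norm_kronRearrange (A - B ⊗ₖ C), kronRearrange_sub, kronRearrange_kronecker]

/-- The same for a sum of Kronecker terms:
`‖A − Σ_k B_k ⊗ C_k‖_F = ‖𝓡(A) − Σ_k vec(B_k) vec(C_k)ᵀ‖_F` (the rank-`r̃` truncation problem
behind (12.3.19)). [cite: GolubVanLoan2013, §12.3.6 (12.3.19)] -/
theorem frobenius_norm_sub_sum_kronecker [NonUnitalSeminormedRing R] {ι : Type*} (s : Finset ι)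
    (A : Matrix (m₁ × m₂) (n₁ × n₂) R) (B : ι → Matrix m₁ n₁ R) (C : ι → Matrix m₂ n₂ R) :
    ‖A - ∑ k ∈ s, B k ⊗ₖ C k‖ =
      ‖kronRearrange A - ∑ k ∈ s, vecMulVec (fun ij => B k ij.1 ij.2) fun pq => C k pq.1 pq.2‖ := by
  rw [← frobenius_norm_kronRearrange (A - _), kronRearrange_sub, kronRearrange_sum_kronecker]

end Frobenius

/-! ## The Kronecker (product) rank -/

section Rank

variable {K : Type u} [Field K]
variable [Fintype m₁] [Fintype m₂] [Fintype n₁] [Fintype n₂]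

/-- Sub-additivity of matrix rank. [folklore] -/
private theorem kr_rank_add_le {p q : Type*} [Fintype p] [Fintype q] (A B : Matrix p q K) :
    (A + B).rank ≤ A.rank + B.rank := by
  unfold Matrix.rank
  rw [Matrix.mulVecLin_add]
  calc Module.finrank K ↥(LinearMap.range (A.mulVecLin + B.mulVecLin))
      ≤ Module.finrank K ↥(LinearMap.range A.mulVecLin ⊔ LinearMap.range B.mulVecLin) :=
        Submodule.finrank_mono (LinearMap.range_add_le _ _)
    _ ≤ _ := Submodule.finrank_add_le_finrank_add_finrank _ _

/-- Sub-additivity of matrix rank over finite sums. [folklore] -/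
private theorem kr_rank_sum_le {p q ι : Type*} [Fintype p] [Fintype q] (s : Finset ι)
    (A : ι → Matrix p q K) : (∑ i ∈ s, A i).rank ≤ ∑ i ∈ s, (A i).rank := by
  classical
  induction s using Finset.induction_on with
  | empty => simp
  | insert a s ha ih =>
    rw [Finset.sum_insert ha, Finset.sum_insert ha]
    exact (kr_rank_add_le _ _).trans (by gcongr)

/-- Every matrix of rank `r` over a field is a sum of `r` rank-one matrices `u_k v_kᵀ` (a rank
factorisation; over `ℝ`/`ℂ` the SVD (12.3.17) is one). [folklore] -/
private theorem kr_exists_eq_sum_vecMulVec {p q : Type*} [Fintype p] [Fintype q]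
    (M : Matrix p q K) :
    ∃ (u : Fin M.rank → p → K) (v : Fin M.rank → q → K), M = ∑ k, vecMulVec (u k) (v k) := by
  rw [Matrix.rank_eq_finrank_span_cols]
  set V := Submodule.span K (Set.range M.col) with hV
  let b := Module.finBasis K V
  have hcol : ∀ j, M.col j ∈ V := fun j => Submodule.subset_span ⟨j, rfl⟩
  refine ⟨fun k i => (b k : p → K) i, fun k j => b.repr ⟨M.col j, hcol j⟩ k, ?_⟩
  ext i j
  have h := b.sum_repr ⟨M.col j, hcol j⟩
  have h' := congr_fun (congr_arg Subtype.val h) i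
  simp only [Submodule.coe_sum, Submodule.coe_smul, Finset.sum_apply,
    Pi.smul_apply, smul_eq_mul] at h'
  rw [Matrix.sum_apply]
  simp only [vecMulVec_apply]
  rw [show M i j = M.col j i from rfl, ← h']
  exact Finset.sum_congr rfl fun k _ => mul_comm _ _

/-- The **Kronecker (product) rank** of `A` for the blocking `(m₁ × m₂) × (n₁ × n₂)`: the rank of
`𝓡(A)` ("the integer `r` in the theorem is the Kronecker product rank of `A` given the blocking
(12.3.16)"). [cite: GolubVanLoan2013, Thm. 12.3.1] -/
def kronRank (A : Matrix (m₁ × m₂) (n₁ × n₂) K) : ℕ := (kronRearrange A).rank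

omit [Fintype m₁] [Fintype n₁] in
/-- [cite: GolubVanLoan2013, Thm. 12.3.1] -/
theorem kronRank_eq (A : Matrix (m₁ × m₂) (n₁ × n₂) K) : kronRank A = (kronRearrange A).rank := rfl

omit [Fintype m₁] [Fintype n₁] in
/-- A single Kronecker product has Kronecker rank `≤ 1`. [cite: GolubVanLoan2013, Thm. 12.3.1] -/
theorem kronRank_kronecker_le_one (B : Matrix m₁ n₁ K) (C : Matrix m₂ n₂ K) :
    kronRank (B ⊗ₖ C) ≤ 1 := by
  rw [kronRank, kronRearrange_kronecker]
  exact Matrix.rank_vecMulVec_le _ _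

/-- **A sum of `|s|` Kronecker products has Kronecker rank `≤ |s|`** ("if `A` is the sum of `p`
Kronecker products … then `rank(𝓡(A)) ≤ p`").
[cite: VanLoan2000, §6 (p. 95)] [cite: GolubVanLoan2013, Thm. 12.3.1] -/
theorem kronRank_sum_kronecker_le {ι : Type*} (s : Finset ι) (B : ι → Matrix m₁ n₁ K)
    (C : ι → Matrix m₂ n₂ K) : kronRank (∑ k ∈ s, B k ⊗ₖ C k) ≤ s.card := by
  rw [kronRank, kronRearrange_sum_kronecker]
  refine (kr_rank_sum_le s _).trans ?_
  calc ∑ k ∈ s, (vecMulVec (fun ij : m₁ × n₁ => B k ij.1 ij.2)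
          fun pq : m₂ × n₂ => C k pq.1 pq.2).rank
      ≤ ∑ _k ∈ s, 1 := Finset.sum_le_sum fun k _ => Matrix.rank_vecMulVec_le _ _
    _ = s.card := by simp

/-- `kronRank A ≤ r` whenever `A` is a sum of `r` Kronecker products.
[cite: GolubVanLoan2013, Thm. 12.3.1] -/
theorem kronRank_le_of_eq_sum {r : ℕ} {A : Matrix (m₁ × m₂) (n₁ × n₂) K}
    {B : Fin r → Matrix m₁ n₁ K} {C : Fin r → Matrix m₂ n₂ K} (h : A = ∑ k, B k ⊗ₖ C k) :
    kronRank A ≤ r := by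
  rw [h]
  simpa using kronRank_sum_kronecker_le Finset.univ B C

/-- **Theorem 12.3.1, existence form: `A` is a sum of exactly `kronRank A` Kronecker products**
(feed any rank factorisation `𝓡(A) = Σ_{k < r} u_k v_kᵀ`, `r = rank 𝓡(A)`, into the reshaping;
over `ℝ` the SVD gives (12.3.18), the KPSVD (10) of Van Loan 2000).
[cite: GolubVanLoan2013, Thm. 12.3.1] [cite: VanLoan2000, §6 (10)] -/
theorem exists_eq_sum_kronecker (A : Matrix (m₁ × m₂) (n₁ × n₂) K) :
    ∃ (B : Fin (kronRank A) → Matrix m₁ n₁ K) (C : Fin (kronRank A) → Matrix m₂ n₂ K),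
      A = ∑ k, B k ⊗ₖ C k := by
  obtain ⟨u, v, h⟩ := kr_exists_eq_sum_vecMulVec (kronRearrange A)
  exact ⟨fun k => of fun i j => u k (i, j), fun k => of fun p q => v k (p, q),
    eq_sum_kronecker_of_kronRearrange (s := Finset.univ) h⟩

/-- **The Kronecker rank is the least number of Kronecker products summing to `A`.**
[cite: GolubVanLoan2013, Thm. 12.3.1] -/
theorem isLeast_kronRank (A : Matrix (m₁ × m₂) (n₁ × n₂) K) :
    IsLeast {r : ℕ | ∃ (B : Fin r → Matrix m₁ n₁ K) (C : Fin r → Matrix m₂ n₂ K),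
      A = ∑ k, B k ⊗ₖ C k} (kronRank A) :=
  ⟨exists_eq_sum_kronecker A, fun _ ⟨_, _, h⟩ => kronRank_le_of_eq_sum h⟩

/-- `kronRank A = 0 ↔ A = 0`. [cite: GolubVanLoan2013, Thm. 12.3.1] -/
theorem kronRank_eq_zero_iff (A : Matrix (m₁ × m₂) (n₁ × n₂) K) : kronRank A = 0 ↔ A = 0 := by
  constructor
  · intro h
    obtain ⟨B, C, hA⟩ := exists_eq_sum_kronecker A
    rw [hA]
    exact Finset.sum_eq_zero fun k _ => (Fin.cast h k).elim0
  · rintro rfl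
    simp [kronRank]

omit [Fintype m₁] [Fintype n₁] in
/-- The Kronecker rank of `A` and of `Aᵀ` (blocking transposed) agree.
[cite: GolubVanLoan2013, Thm. 12.3.1] -/
theorem kronRank_transpose (A : Matrix (m₁ × m₂) (n₁ × n₂) K) : kronRank Aᵀ = kronRank A := by
  rw [kronRank, kronRearrange_transpose, kronRank]
  exact Matrix.rank_submatrix _ (Equiv.prodComm n₁ m₁) (Equiv.prodComm n₂ m₂)

end Rank

end Literature.LinearAlgebra.TensorNetworks
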